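import Literature.NumberTheory.Automorphic.UnitaryGroupArchEmbedding
import HarnessLib

/-!
# The archimedean projection at a complex EMBEDDING: `U(J)(E ⊗ ℝ) →* U(2,1)` through a frame

Registry: pub-hodgecm MODEL-CONSTRUCTION sub-cell, EMB-INSTANCE chain link (4) ("arch junction"), automorphic lane
(node D1-aut-ix-b, part 2 of 2; continues `UnitaryGroupArchEmbedding`). Everything is proved (kernel); no named facts.

* § 3 `N = 3`, frame `T` with `Tᴴ τ(J) T = diag(1,1,-1)` (the shape of a Sylvester frame `Tᴴ H^{τ₁} T = J₀` of a ball-quotient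
  datum): `formEquivU21 : U(τ(J)) ≃ₜ* U21` (`g ↦ T⁻¹ g T`) and **`archProjU21Emb τ T hT : U(J)(E ⊗ ℝ) →* U21`**,
  `g ↦ T⁻¹ (evalEmb τ g) T`; `coe_archProjU21Emb_rationalToArch : archProjU21Emb (γ ⊗ 1) = T⁻¹ · GL₃(τ) γ · T` — the
  geometric lane's `ballRep` formula `t⁻¹ γ^{τ₁} t` (`UnitaryBallAutomorphicForms.mat_ballRep`), with no conjugation
  ambiguity; continuous, surjective, open, compact kernel under definiteness at the places `≠ mk τ`.
* § 4 CM specialisation `archProjU21EmbCM L H τ T hT` (`F = L⁺`, `c` = complex conjugation; every embedding of a CM field is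
  complex); `isCompact_ker_archProjU21EmbCM_of_posDef` takes definiteness in the datum's embedding spelling
  `∀ τ', mk τ' ≠ mk τ → (H.map τ').PosDef`.
References for the objects: Platonov–Rapinchuk 1994 §2.3, §3.2; Borel–Jacquet 1979 §4.1.
-/

set_option autoImplicit false

noncomputable section

open NumberField NumberField.InfinitePlace Topology

open scoped Matrix MatrixGroups ComplexConjugate ComplexOrder

namespace Literature.NumberTheory.Automorphic

namespace UnitaryGroup

open NumberField.mixedEmbedding Literature.Geometry.ComplexHyperbolic Literature.Geometry.ComplexHyperbolic.BallModel

variable (F E : Type) [Field F] [NumberField F] [Field E] [NumberField E] [Algebra F E]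
  (c : E ≃ₐ[F] E)

/-! ## § 3. `N = 3`: the projection to `U(2,1)` at an embedding, through a frame -/

section U21Emb

variable (J₃ : Matrix (Fin 3) (Fin 3) E) (τ : E →+* ℂ) (hτ : IsComplex (InfinitePlace.mk τ))
  (T : GL (Fin 3) ℂ) (hT : formCongr (starRingEnd ℂ) T (J₃.map τ) = BallModel.J)
  (hw : c • InfinitePlace.mk τ = InfinitePlace.mk τ) (hc : c ≠ 1)

omit [NumberField E] in
/-- `U(τ(J))(ℂ) ≃ₜ* U(2,1)`, `g ↦ T⁻¹ g T`, for a frame `T` with `Tᴴ τ(J) T = diag(1,1,-1)`. [cite: PlatonovRapinchuk1994, §2.3] -/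
def formEquivU21 : unitaryGroupOfForm (starRingEnd ℂ) (J₃.map τ) ≃ₜ* U21 :=
  (unitaryGroupOfFormCongrOfEq (starRingEnd ℂ) T (J₃.map τ) BallModel.J hT).symm.trans
    (subgroupCongrTop U21_eq_unitaryGroupOfForm.symm)

omit [NumberField E] in
/-- `formEquivU21 g = T⁻¹ g T` on underlying invertible matrices. [folklore] -/
@[simp] theorem coe_formEquivU21_apply (g : unitaryGroupOfForm (starRingEnd ℂ) (J₃.map τ)) :
    ((formEquivU21 E J₃ τ T hT g : U21) : GL (Fin 3) ℂ) = T⁻¹ * g * T := rfl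

omit [NumberField F] [NumberField E] in
/-- **The archimedean projection at the embedding `τ`: `U(J)(E ⊗ ℝ) →* U(2,1)`, `g ↦ T⁻¹ (evalEmb τ g) T`.**
[cite: BorelJacquet1979, §4.1] -/
def archProjU21Emb : arch F E c 3 J₃ →* U21 :=
  (formEquivU21 E J₃ τ T hT).toMonoidHom.comp (archAtEmb F E c 3 J₃ τ hτ hw hc)

omit [NumberField F] [NumberField E] in
/-- `archProjU21Emb g = T⁻¹ (archAtEmb τ g) T` on underlying invertible matrices. [folklore] -/
@[simp] theorem coe_archProjU21Emb_apply (g : arch F E c 3 J₃) :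
    ((archProjU21Emb F E c J₃ τ hτ T hT hw hc g : U21) : GL (Fin 3) ℂ) =
      T⁻¹ * (archAtEmb F E c 3 J₃ τ hτ hw hc g : unitaryGroupOfForm (starRingEnd ℂ) (J₃.map τ)) * T :=
  rfl

omit [NumberField F] [NumberField E] in
/-- **On rational points: `archProjU21Emb (γ ⊗ 1) = T⁻¹ · GL₃(τ) γ · T`** — the `ballRep` formula of the geometric
lane (`t⁻¹ γ^{τ₁} t`), with no conjugation ambiguity. [folklore] -/
theorem coe_archProjU21Emb_rationalToArch (γ : rational F E c 3 J₃) :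
    ((archProjU21Emb F E c J₃ τ hτ T hT hw hc (rationalToArch F E c 3 J₃ γ) : U21) : GL (Fin 3) ℂ) =
      T⁻¹ * Matrix.GeneralLinearGroup.map τ (γ : GL (Fin 3) E) * T := by
  rw [coe_archProjU21Emb_apply, coe_archAtEmb_rationalToArch]

omit [NumberField F] [NumberField E] in
/-- `archProjU21Emb` is continuous. [folklore] -/
theorem continuous_archProjU21Emb : Continuous (archProjU21Emb F E c J₃ τ hτ T hT hw hc) :=
  (formEquivU21 E J₃ τ T hT).continuous.comp (continuous_archAtEmb F E c 3 J₃ τ hτ hw hc)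

omit [NumberField F] [NumberField E] in
/-- `ker archProjU21Emb = ker (archAt (mk τ))`. [folklore] -/
theorem ker_archProjU21Emb :
    (archProjU21Emb F E c J₃ τ hτ T hT hw hc).ker = (archAt F E c 3 J₃ (placeOf E τ hτ) hw hc).ker := by
  rw [← ker_archAtEmb F E c 3 J₃ τ hτ hw hc]
  ext g
  rw [MonoidHom.mem_ker, MonoidHom.mem_ker, archProjU21Emb, MonoidHom.comp_apply]
  exact map_eq_one_iff _ (formEquivU21 E J₃ τ T hT).injective

variable (hfix : ∀ w : InfinitePlace E, c • w = w)

omit [NumberField F] [NumberField E] in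
include hfix in
/-- **`archProjU21Emb` is surjective** (when `c ≠ 1` fixes every infinite place). [folklore] -/
theorem archProjU21Emb_surjective : Function.Surjective (archProjU21Emb F E c J₃ τ hτ T hT (hfix _) hc) :=
  (formEquivU21 E J₃ τ T hT).surjective.comp (archAtEmb_surjective F E c 3 J₃ τ hτ hc hfix)

omit [NumberField F] [NumberField E] in
include hfix in
/-- **`archProjU21Emb` is an open map** (when `c ≠ 1` fixes every infinite place). [folklore] -/
theorem isOpenMap_archProjU21Emb : IsOpenMap (archProjU21Emb F E c J₃ τ hτ T hT (hfix _) hc) :=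
  (formEquivU21 E J₃ τ T hT).toHomeomorph.isOpenMap.comp (isOpenMap_archAtEmb F E c 3 J₃ τ hτ hc hfix)

omit [NumberField F] [NumberField E] in
include hfix in
/-- **The kernel of `archProjU21Emb` is compact when `σ_w(J)` is definite at every place `w ≠ mk τ`.**
[cite: PlatonovRapinchuk1994, §3.2 Thm 3.1] -/
theorem isCompact_ker_archProjU21Emb
    (hdef : ∀ w : {w : InfinitePlace E // IsComplex w}, w ≠ placeOf E τ hτ →
      (J₃.map w.1.embedding).PosDef ∨ (-J₃.map w.1.embedding).PosDef) :
    IsCompact ((archProjU21Emb F E c J₃ τ hτ T hT (hfix _) hc).ker : Set (arch F E c 3 J₃)) := by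
  rw [ker_archProjU21Emb]
  exact isCompact_ker_archAt F E c 3 J₃ hc hfix (placeOf E τ hτ) hdef

end U21Emb

/-! ## § 4. The CM case -/

section CM

variable (L : Type) [Field L] [NumberField L] [IsCMField L] (H : Matrix (Fin 3) (Fin 3) L)
  (τ : L →+* ℂ) (T : GL (Fin 3) ℂ) (hT : formCongr (starRingEnd ℂ) T (H.map τ) = BallModel.J)

/-- Every embedding of a CM field is complex. [folklore] -/
theorem isComplex_mk_of_isCMField : IsComplex (InfinitePlace.mk τ) :=
  IsTotallyComplex.isComplex _

/-- **CM case: the archimedean projection at the embedding `τ`, `U(H)(L ⊗ ℝ) →* U(2,1)`** (`F = L⁺`, `c` = complex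
conjugation), for a frame `T` with `Tᴴ τ(H) T = diag(1,1,-1)`. [cite: BorelJacquet1979, §4.1] -/
def archProjU21EmbCM : arch (↥(maximalRealSubfield L)) L (IsCMField.complexConj L) 3 H →* U21 :=
  archProjU21Emb _ L (IsCMField.complexConj L) H τ (isComplex_mk_of_isCMField L τ) T hT
    (complexConj_smul_infinitePlace L _) (IsCMField.complexConj_ne_one L)

/-- CM case, rational points: `archProjU21EmbCM (γ ⊗ 1) = T⁻¹ · GL₃(τ) γ · T`. [folklore] -/
theorem coe_archProjU21EmbCM_rationalToArch
    (γ : rational (↥(maximalRealSubfield L)) L (IsCMField.complexConj L) 3 H) :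
    ((archProjU21EmbCM L H τ T hT (rationalToArch (↥(maximalRealSubfield L)) L (IsCMField.complexConj L) 3 H γ) :
        U21) : GL (Fin 3) ℂ) =
      T⁻¹ * Matrix.GeneralLinearGroup.map τ (γ : GL (Fin 3) L) * T :=
  coe_archProjU21Emb_rationalToArch _ L _ H τ _ T hT _ _ γ

/-- `archProjU21EmbCM` is continuous. [folklore] -/
theorem continuous_archProjU21EmbCM : Continuous (archProjU21EmbCM L H τ T hT) :=
  continuous_archProjU21Emb _ L _ H τ _ T hT _ _

/-- `archProjU21EmbCM` is surjective. [folklore] -/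
theorem archProjU21EmbCM_surjective : Function.Surjective (archProjU21EmbCM L H τ T hT) :=
  archProjU21Emb_surjective _ L _ H τ _ T hT _ (complexConj_smul_infinitePlace L)

/-- `archProjU21EmbCM` is an open map. [folklore] -/
theorem isOpenMap_archProjU21EmbCM : IsOpenMap (archProjU21EmbCM L H τ T hT) :=
  isOpenMap_archProjU21Emb _ L _ H τ _ T hT _ (complexConj_smul_infinitePlace L)

/-- **CM case: compact kernel under definiteness at the places `≠ mk τ`** (signature `(2,1)` at `τ`, `(3,0)` elsewhere).
[cite: PlatonovRapinchuk1994, §3.2 Thm 3.1] -/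
theorem isCompact_ker_archProjU21EmbCM
    (hdef : ∀ w : {w : InfinitePlace L // IsComplex w}, w.1 ≠ InfinitePlace.mk τ →
      (H.map w.1.embedding).PosDef ∨ (-H.map w.1.embedding).PosDef) :
    IsCompact ((archProjU21EmbCM L H τ T hT).ker :
      Set (arch (↥(maximalRealSubfield L)) L (IsCMField.complexConj L) 3 H)) :=
  isCompact_ker_archProjU21Emb _ L _ H τ _ T hT _ (complexConj_smul_infinitePlace L) fun w hw =>
    hdef w fun h => hw (Subtype.ext h)

/-- Same, with definiteness phrased over EMBEDDINGS (the shape of the ball-quotient datum field `posDef_of_ne`: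
`∀ τ', mk τ' ≠ mk τ₁ → (H.map τ').PosDef`). [cite: PlatonovRapinchuk1994, §3.2 Thm 3.1] -/
theorem isCompact_ker_archProjU21EmbCM_of_posDef
    (hdef : ∀ τ' : L →+* ℂ, InfinitePlace.mk τ' ≠ InfinitePlace.mk τ → (H.map τ').PosDef) :
    IsCompact ((archProjU21EmbCM L H τ T hT).ker :
      Set (arch (↥(maximalRealSubfield L)) L (IsCMField.complexConj L) 3 H)) :=
  isCompact_ker_archProjU21EmbCM L H τ T hT fun w hw => Or.inl (hdef w.1.embedding (by rwa [mk_embedding]))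

end CM

end UnitaryGroup

end Literature.NumberTheory.Automorphic

end
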